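import Literature.AlgebraicGeometry.Resolution.DivisorialPart
import Literature.AlgebraicGeometry.Resolution.AlterationsResolution
import Literature.AlgebraicGeometry.Resolution.AlterationsNormalizationReduction
import Literature.AlgebraicGeometry.Resolution.RationalSurfaceSingularitiesBasic
import HarnessLib

/-!
# Principalization of ideal sheaves on a regular scheme reduces to ideals of codimension `≥ 2`
# (the divisorial part is already invertible — Cossart–Piltant 2008, proof of Prop. 4.2)

Topic: `Literature/AlgebraicGeometry/Resolution`. PROVED, fact-free, definition-free (hand
leafhand-res-homologicalconduct-16 g2 of the cell decomp-res; AI-written bookkeeping over tree theorems,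
weaker than expert review).

Cossart–Piltant, J. Algebra 320 (2008), proof of Prop. 4.2 (p. 7): «Let `E_1, …, E_m` be the irreducible
components of codimension one of `Z := V(I)_red`, and `a(j) := ord_{E_j} I` … `H := 𝒪_X(-∑ a(i)E_i) ⊆ I`, and
`J := H⁻¹ I ⊆ 𝒪_X` is such that `V(J)` has codimension at least two in `X`. … Clearly `I` is locally principal
⇔ `μ = 0` ⇔ `J = 𝒪_X`.»  In the tree this is `exists_divisorial_decomposition` (`DivisorialPart.lean`: on a regular
integral Noetherian scheme every non-zero ideal sheaf is `I = H · J` with `H` an effective Cartier divisor and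
`V(J)` = the non-locally-principal locus of `I`, all of whose points have codimension `≥ 2`).  CONSEQUENCE proved
here: **to principalize all non-zero ideal sheaves of a regular integral Noetherian scheme `X` by resolutions
`j : Z → X` (proper birational, `Z` regular, `I·𝒪_Z` an effective Cartier divisor) it suffices to principalize
those whose cosupport has codimension `≥ 2`** — because `(H·J)·𝒪_Z = H·𝒪_Z · J·𝒪_Z` (`comap_mul`), the
pull-back of the effective Cartier `H` along the dominant `j` from the integral `Z` is effective Cartier
(`IsEffectiveCartier.comap_of_isDominant`), and products of effective Cartier divisors are effective Cartier
(`IsEffectiveCartier.mul`).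

* `isEffectiveCartier_comap_of_isResolution_of_mul` — for a resolution `j : Z → X` of `X` and `I = H · J`, `H` effective Cartier:
  `I·𝒪_Z` is effective Cartier as soon as `J·𝒪_Z` is;
* `principalization_of_codimTwo` — the reduction: principalization of the ideal sheaves with cosupport of
  codimension `≥ 2` (every point of the support of coheight `> 1`) implies principalization of every non-zero
  ideal sheaf, in the shape of the hypothesis (PRINC) of `Lipman1969_1_2_B_of_principalization`
  (`Lipman1969StatementBOfPrincipalization.lean`).

On a regular SURFACE the remaining ideals have FINITE cosupport consisting of closed points (tree, private
plumbing of `ResolutionDominatedByBlowup.lean`), i.e. what is left of (PRINC) is the principalization of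
finite-colength ideals by point blow-ups (Zariski; Kollár 2007 Thm. 1.74) — NOT here.  No summit statement is
proved.

## References
* V. Cossart, O. Piltant, *Resolution of singularities of threefolds in positive characteristic I*, J. Algebra
  320 (2008), proof of Prop. 4.2 (p. 7). [CossartPiltant2008]
* J. Kollár, *Lectures on Resolution of Singularities* (2007), Thm. 1.74. [Kollar2007]
-/

noncomputable section

open CategoryTheory CategoryTheory.Limits AlgebraicGeometry TopologicalSpace

universe u

namespace Literature.AlgebraicGeometry.Resolution

open Scheme.IdealSheafData

/-- **The divisorial part is no obstruction.** `X` regular integral Noetherian, `I ≠ 0` an ideal sheaf with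
divisorial decomposition `I = H · J` (`exists_divisorial_decomposition`), `j : Z → X` a resolution: if `J·𝒪_Z`
is an effective Cartier divisor then so is `I·𝒪_Z = H·𝒪_Z · J·𝒪_Z` (`H·𝒪_Z` is effective Cartier, `j` being
dominant from the integral `Z`). Stated with `H`, `J` as data satisfying `IsEffectiveCartier H ∧ H * J = I`.
[cite: CossartPiltant2008, proof of Prop. 4.2 (p. 7)] -/
theorem isEffectiveCartier_comap_of_isResolution_of_mul {X Z : Scheme.{u}} [IsIntegral X]
    {I H J : X.IdealSheafData} (hH : IsEffectiveCartier H) (hHJ : H * J = I)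
    {j : Z ⟶ X} (hj : IsResolution j) (hJ : IsEffectiveCartier (J.comap j)) :
    IsEffectiveCartier (I.comap j) := by
  haveI : IsIntegral Z := hj.isIntegral_source
  haveI : IsDominant j := hj.isBirational.isDominant
  haveI : IsProper j := hj.isProper
  rw [← hHJ, comap_mul]
  exact (hH.comap_of_isDominant j).mul hJ

/-- **Principalization reduces to codimension `≥ 2`.** Let `X` be a regular integral Noetherian scheme such
that every non-zero ideal sheaf `J` all of whose cosupport points have codimension `≥ 2` (`1 < coheight x` for
`x ∈ V(J)`) is principalized by some resolution `j : Z → X` (`J·𝒪_Z` effective Cartier). Then EVERY non-zero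
ideal sheaf of `X` is principalized by some resolution — write `I = H · J` (Cossart–Piltant's divisorial part,
`exists_divisorial_decomposition`) and principalize `J`. This is the hypothesis (PRINC) of
`Lipman1969_1_2_B_of_principalization` from its codimension-two case.
[cite: CossartPiltant2008, proof of Prop. 4.2 (p. 7)] [cite: Kollar2007, Thm. 1.74] -/
theorem principalization_of_codimTwo {X : Scheme.{u}} [IsIntegral X] [IsNoetherian X]
    (hX : Scheme.IsRegular X)
    (hfin : ∀ J : X.IdealSheafData, J ≠ ⊥ → (∀ x ∈ J.support, 1 < Order.coheight x) →
      ∃ (Z : Scheme.{u}) (j : Z ⟶ X), IsResolution j ∧ IsEffectiveCartier (J.comap j))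
    (I : X.IdealSheafData) (hI : I ≠ ⊥) :
    ∃ (Z : Scheme.{u}) (j : Z ⟶ X), IsResolution j ∧ IsEffectiveCartier (I.comap j) := by
  obtain ⟨H, J, hH, hHJ, hIJ, -, hcodim⟩ := exists_divisorial_decomposition hX hI
  have hJ0 : J ≠ ⊥ := fun h => hI (le_bot_iff.mp (h ▸ hIJ))
  obtain ⟨Z, j, hj, hJ⟩ := hfin J hJ0 hcodim
  exact ⟨Z, j, hj, isEffectiveCartier_comap_of_isResolution_of_mul hH hHJ hj hJ⟩

end Literature.AlgebraicGeometry.Resolution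

end
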